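import Summits.CriticalPhenomena.SAWScalingLimit.Theorems.SAWTotalPositivityBoundaryTP2Defs
import Summits.CriticalPhenomena.SAWScalingLimit.Theorems.SAWTotalPositivityBoundaryTP2Kernel
import Summits.CriticalPhenomena.SAWScalingLimit.Theorems.SAWTotalPositivityBoundaryTP2TwoEdgeCut
import HarnessLib

/-!
# Crux `BoundaryTP2` (stmt-CriticalPhenomena-7115), line `Sketch`: pockets behind a two-edge mouth inherit TP₂

For the fugacity-`x` self-avoiding path kernel `Z_H(a,b) = pathKernel H x a b = Σ_{γ : a → b} x^{|γ|}`
and a vertex set `A` ("pocket") left by exactly two oriented edges `e₁e₂`, `f₁f₂` of `H` (its "mouth"),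
the landed factorisation `stub_twoEdgeCut_factor` writes, for `a ∈ A` and `b ∉ A`,

`Z_H(a,b) = x · (Z_A(a,e₁) Z_{Aᶜ}(e₂,b) + Z_A(a,f₁) Z_{Aᶜ}(f₂,b))`,

i.e. the `2 × 2` block `(Z_H(a,b))_{a ∈ {a,a'}, b ∈ {u,v}}` is `x · M · N` with
`M = [[Z_A(a,e₁), Z_A(a,f₁)], [Z_A(a',e₁), Z_A(a',f₁)]]` and
`N = [[Z_{Aᶜ}(e₂,u), Z_{Aᶜ}(e₂,v)], [Z_{Aᶜ}(f₂,u), Z_{Aᶜ}(f₂,v)]]`. Cauchy–Binet for `2 × 2` matrices,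
`det (M N) = det M · det N`, then shows that TP₂ of the two sides (`det M ≥ 0`, `det N ≥ 0`) is inherited
by `H`: `Z(a,v) Z(a',u) ≤ Z(a,u) Z(a',v)` (`twoEdgeCut_tp2_inherit`, a registered stub of the line's
skeleton: "TP₂ is multiplicative across 2-edge bottlenecks"). Since all kernels of a graph with finitely
many non-isolated vertices are finite (`pathKernel_ne_top`), the `ℝ≥0∞`-inequality is the cast of a
polynomial inequality over `ℝ`, where it is the identity
`(MN)₁₁(MN)₂₂ − (MN)₁₂(MN)₂₁ = (M₁₁M₂₂ − M₁₂M₂₁)(N₁₁N₂₂ − N₁₂N₂₁)`.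
Everything here is proved; Mathlib only. [folklore]
-/

namespace Summit.CriticalPhenomena.SAWScalingLimit.Theorems.BoundaryTP2

open SimpleGraph Literature.Probability.LatticeModels Literature.Probability.RandomPlanarGeometry
open scoped ENNReal NNReal

variable {V : Type*}

/-- **Cauchy–Binet sign rule for `2 × 2` blocks in `ℝ≥0∞`.** If `M₁₂M₂₁ ≤ M₁₁M₂₂` and
`N₁₂N₂₁ ≤ N₁₁N₂₂` for finite entries, then the product matrix `x · M · N` satisfies
`(xMN)₁₂ (xMN)₂₁ ≤ (xMN)₁₁ (xMN)₂₂`. Proof: lift to `ℝ≥0`, cast to `ℝ`, where the difference is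
`x² (M₁₁M₂₂ − M₁₂M₂₁)(N₁₁N₂₂ − N₁₂N₂₁) ≥ 0`. [folklore] -/
private theorem twoByTwo_cauchyBinet_le {x M₁₁ M₁₂ M₂₁ M₂₂ N₁₁ N₁₂ N₂₁ N₂₂ : ℝ≥0∞} (hx : x ≠ ∞)
    (h₁₁ : M₁₁ ≠ ∞) (h₁₂ : M₁₂ ≠ ∞) (h₂₁ : M₂₁ ≠ ∞) (h₂₂ : M₂₂ ≠ ∞)
    (k₁₁ : N₁₁ ≠ ∞) (k₁₂ : N₁₂ ≠ ∞) (k₂₁ : N₂₁ ≠ ∞) (k₂₂ : N₂₂ ≠ ∞)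
    (hA : M₁₂ * M₂₁ ≤ M₁₁ * M₂₂) (hB : N₁₂ * N₂₁ ≤ N₁₁ * N₂₂) :
    x * (M₁₁ * N₁₂ + M₁₂ * N₂₂) * (x * (M₂₁ * N₁₁ + M₂₂ * N₂₁)) ≤
      x * (M₁₁ * N₁₁ + M₁₂ * N₂₁) * (x * (M₂₁ * N₁₂ + M₂₂ * N₂₂)) := by
  lift x to ℝ≥0 using hx
  lift M₁₁ to ℝ≥0 using h₁₁
  lift M₁₂ to ℝ≥0 using h₁₂
  lift M₂₁ to ℝ≥0 using h₂₁
  lift M₂₂ to ℝ≥0 using h₂₂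
  lift N₁₁ to ℝ≥0 using k₁₁
  lift N₁₂ to ℝ≥0 using k₁₂
  lift N₂₁ to ℝ≥0 using k₂₁
  lift N₂₂ to ℝ≥0 using k₂₂
  have hA' : ((M₁₂ : ℝ≥0) : ℝ) * M₂₁ ≤ M₁₁ * M₂₂ := by exact_mod_cast hA
  have hB' : ((N₁₂ : ℝ≥0) : ℝ) * N₂₁ ≤ N₁₁ * N₂₂ := by exact_mod_cast hB
  have key : ((x : ℝ≥0) : ℝ) * (M₁₁ * N₁₂ + M₁₂ * N₂₂) * (x * (M₂₁ * N₁₁ + M₂₂ * N₂₁)) ≤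
      x * (M₁₁ * N₁₁ + M₁₂ * N₂₁) * (x * (M₂₁ * N₁₂ + M₂₂ * N₂₂)) := by
    nlinarith [mul_nonneg (mul_self_nonneg (x : ℝ))
      (mul_nonneg (sub_nonneg.2 hA') (sub_nonneg.2 hB'))]
  exact_mod_cast key

/-- **Pockets behind a two-edge mouth inherit TP₂** (registered stub `twoEdgeCut_tp2_inherit` of the
line `Sketch` of crux `BoundaryTP2`). Let the only edges of `H` oriented from `A` to `Aᶜ` be `e₁e₂` and
`f₁f₂` (distinct as oriented edges), let `a, a' ∈ A`, `u, v ∉ A`, `0 ≤ x`, and let `H` have finitely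
many non-isolated vertices. If the inside kernel `Z_A` (graph `SimpleGraph.fromRel (H.Adj p q ∧ p ∈ A ∧ q ∈ A)`)
satisfies `Z_A(a,f₁) Z_A(a',e₁) ≤ Z_A(a,e₁) Z_A(a',f₁)` and the outside kernel `Z_{Aᶜ}`
(graph `SimpleGraph.fromRel (H.Adj p q ∧ p ∉ A ∧ q ∉ A)`) satisfies
`Z_{Aᶜ}(e₂,v) Z_{Aᶜ}(f₂,u) ≤ Z_{Aᶜ}(e₂,u) Z_{Aᶜ}(f₂,v)`, then
`Z_H(a,v) Z_H(a',u) ≤ Z_H(a,u) Z_H(a',v)`: by `stub_twoEdgeCut_factor` the four kernels of `H` are the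
entries of `x · M · N`, and `det (MN) = det M · det N` (`twoByTwo_cauchyBinet_le`). [folklore] -/
theorem twoEdgeCut_tp2_inherit (H : SimpleGraph V) (x : ℝ) (hx : 0 ≤ x) (hfin : H.support.Finite)
    (A : Set V) (e₁ e₂ f₁ f₂ a a' u v : V)
    (hcut : ∀ p q, H.Adj p q → p ∈ A → q ∉ A → (p = e₁ ∧ q = e₂) ∨ (p = f₁ ∧ q = f₂))
    (he : H.Adj e₁ e₂) (hf : H.Adj f₁ f₂) (he₁ : e₁ ∈ A) (he₂ : e₂ ∉ A) (hf₁ : f₁ ∈ A) (hf₂ : f₂ ∉ A)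
    (hef : e₁ ≠ f₁ ∨ e₂ ≠ f₂) (ha : a ∈ A) (ha' : a' ∈ A) (hu : u ∉ A) (hv : v ∉ A)
    (hA : pathKernel (SimpleGraph.fromRel fun p q => H.Adj p q ∧ p ∈ A ∧ q ∈ A) x a f₁ *
        pathKernel (SimpleGraph.fromRel fun p q => H.Adj p q ∧ p ∈ A ∧ q ∈ A) x a' e₁ ≤
      pathKernel (SimpleGraph.fromRel fun p q => H.Adj p q ∧ p ∈ A ∧ q ∈ A) x a e₁ *
        pathKernel (SimpleGraph.fromRel fun p q => H.Adj p q ∧ p ∈ A ∧ q ∈ A) x a' f₁)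
    (hB : pathKernel (SimpleGraph.fromRel fun p q => H.Adj p q ∧ p ∉ A ∧ q ∉ A) x e₂ v *
        pathKernel (SimpleGraph.fromRel fun p q => H.Adj p q ∧ p ∉ A ∧ q ∉ A) x f₂ u ≤
      pathKernel (SimpleGraph.fromRel fun p q => H.Adj p q ∧ p ∉ A ∧ q ∉ A) x e₂ u *
        pathKernel (SimpleGraph.fromRel fun p q => H.Adj p q ∧ p ∉ A ∧ q ∉ A) x f₂ v) :
    pathKernel H x a v * pathKernel H x a' u ≤ pathKernel H x a u * pathKernel H x a' v := by
  -- the two side graphs are subgraphs of `H`, hence have finitely many non-isolated vertices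
  have hAle : (SimpleGraph.fromRel fun p q => H.Adj p q ∧ p ∈ A ∧ q ∈ A) ≤ H := by
    intro p q h
    rw [SimpleGraph.fromRel_adj] at h
    rcases h with ⟨-, h | h⟩
    exacts [h.1, h.1.symm]
  have hBle : (SimpleGraph.fromRel fun p q => H.Adj p q ∧ p ∉ A ∧ q ∉ A) ≤ H := by
    intro p q h
    rw [SimpleGraph.fromRel_adj] at h
    rcases h with ⟨-, h | h⟩
    exacts [h.1, h.1.symm]
  have hAfin := hfin.subset (SimpleGraph.support_mono hAle)
  have hBfin := hfin.subset (SimpleGraph.support_mono hBle)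
  -- factor the four kernels of `H` across the cut: the entries of `x · M · N`
  rw [stub_twoEdgeCut_factor H x hx A e₁ e₂ f₁ f₂ a v hcut he hf he₁ he₂ hf₁ hf₂ hef ha hv,
    stub_twoEdgeCut_factor H x hx A e₁ e₂ f₁ f₂ a' u hcut he hf he₁ he₂ hf₁ hf₂ hef ha' hu,
    stub_twoEdgeCut_factor H x hx A e₁ e₂ f₁ f₂ a u hcut he hf he₁ he₂ hf₁ hf₂ hef ha hu,
    stub_twoEdgeCut_factor H x hx A e₁ e₂ f₁ f₂ a' v hcut he hf he₁ he₂ hf₁ hf₂ hef ha' hv]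
  -- Cauchy–Binet
  exact twoByTwo_cauchyBinet_le ENNReal.ofReal_ne_top (pathKernel_ne_top hAfin x a e₁)
    (pathKernel_ne_top hAfin x a f₁) (pathKernel_ne_top hAfin x a' e₁)
    (pathKernel_ne_top hAfin x a' f₁) (pathKernel_ne_top hBfin x e₂ u)
    (pathKernel_ne_top hBfin x e₂ v) (pathKernel_ne_top hBfin x f₂ u)
    (pathKernel_ne_top hBfin x f₂ v) hA hB

end Summit.CriticalPhenomena.SAWScalingLimit.Theorems.BoundaryTP2
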